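import Literature.MathematicalPhysics.QuantumLattice.LTQOProofs
import Literature.MathematicalPhysics.QuantumLattice.SectorEigenvalueContinuation
import HarnessLib

/-!
# Route `JosephsonMirror` — the floor near `U₀` compresses injectively into the floor at `U₀`
# (crux `JmPairBridge`, line `schur-rigid-bridge`, stub `stub_floorUpper`)

Support lemma for the crux item stmt-HubbardSuperconductivity-2226 (`JmPairBridge`) of route
`JosephsonMirror` (sub-problem `HubbardSuperconductivity`), stub `stub_floorUpper` of the checked
line `schur-rigid-bridge`.

Let `u ↦ A u` be Hermitian matrices on `ι → ℂ` preserving a subspace `K`, with quadratic forms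
`u ↦ Re ⟨v, A u v⟩` that are `d`-Lipschitz (`|Re ⟨v, A u v⟩ - Re ⟨v, A u' v⟩| ≤ d |u - u'| ‖v‖²`),
let `m u` be the bottom of `A u` on `K` (a lower bound of the form on `K`, attained at an
eigenvector in `K`), and let the *floor* of `u` be `Fl u = K ⊓ eigenspace (A u) (m u)`. Assume a
strict gap `μ₀ > m U₀` of `A U₀` above its floor on the part of `K` orthogonal to `Fl U₀`. Then for
`|u - U₀| < (μ₀ - m U₀) / (4 (d + 1))`:

* (i) no non-zero vector of `Fl u` is orthogonal to `Fl U₀`: with `r = d |u - U₀|` one has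
  `m u ≤ m U₀ + r` (test the form of `A u` on a floor vector of `U₀`), so a vector `v ∈ Fl u`
  orthogonal to `Fl U₀` satisfies `μ₀ ‖v‖² ≤ Re ⟨v, A U₀ v⟩ ≤ Re ⟨v, A u v⟩ + r ‖v‖²
  = (m u + r) ‖v‖² ≤ (m U₀ + 2 r) ‖v‖²`, and `μ₀ - m U₀ - 2 r > 0` forces `v = 0`;
* (ii) hence `dim Fl u ≤ dim Fl U₀`: by (i) the orthogonal projection onto `Fl U₀` (the Hermitian
  projection matrix `projMatrix`, which maps into `Fl U₀` and fixes it pointwise) is injective on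
  `Fl u`.

Sources: T. Kato, *Perturbation Theory for Linear Operators* (1966), Ch. II §5.1 (continuity of
the eigenvalues and eigenprojections of a symmetric family; upper semicontinuity of the
multiplicity); H. Tasaki, *Physics and Mathematics of Quantum Many-Body Systems* (2020), §2.1 (the
variational characterisation of low-lying eigenvalues). No new definitions.
-/

noncomputable section

-- the mandated namespace `Summit.<Summit>.<Problem>.Theorems` repeats `HubbardSuperconductivity`
-- (single-problem summit), which the `dupNamespace` linter flags on every declaration
set_option linter.dupNamespace false

namespace Summit.HubbardSuperconductivity.HubbardSuperconductivity.Theorems.JosephsonMirror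

open Matrix Literature.MathematicalPhysics.QuantumLattice
  Literature.MathematicalPhysics.QuantumLattice.EigenvalueContinuation

/-- **Orthogonal compression.** If no non-zero vector of the subspace `F₁ ≤ (ι → ℂ)` is orthogonal
to the subspace `F₀`, then `dim F₁ ≤ dim F₀`: the orthogonal projection `P` onto `F₀` (the Hermitian
matrix `projMatrix`, mapping into `F₀` and fixing `F₀` pointwise) restricts to an injective linear
map `F₁ → F₀`, since `P v = 0` gives `⟨w, v⟩ = ⟨P w, v⟩ = ⟨w, P v⟩ = 0` for every `w ∈ F₀`.
Tasaki (2020) App. A.2. [folklore] -/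
theorem floorUpper_finrank_le_of_orthogonal {ι : Type*} [Fintype ι] [DecidableEq ι]
    (F₀ F₁ : Submodule ℂ (ι → ℂ)) (h : ∀ v ∈ F₁, (∀ w ∈ F₀, star w ⬝ᵥ v = 0) → v = 0) :
    Module.finrank ℂ ↥F₁ ≤ Module.finrank ℂ ↥F₀ := by
  -- the orthogonal projection onto `F₀`, as a matrix
  obtain ⟨P, hPH, hPmem, hPfix⟩ : ∃ P : Matrix ι ι ℂ, P.IsHermitian ∧ (∀ x, P *ᵥ x ∈ F₀) ∧
      ∀ x ∈ F₀, P *ᵥ x = x :=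
    ⟨projMatrix (F₀.map ((WithLp.linearEquiv 2 ℂ (ι → ℂ)).symm :
        (ι → ℂ) →ₗ[ℂ] EuclideanSpace ℂ ι)),
      projMatrix_isHermitian _, projMatrix_map_mulVec_mem F₀,
      fun x hx => projMatrix_map_mulVec_of_mem F₀ hx⟩
  -- its restriction `F₁ → F₀` is injective
  refine LinearMap.finrank_le_finrank_of_injective
    (f := LinearMap.codRestrict F₀ ((Matrix.toLin' P).domRestrict F₁) fun x => by
      simpa only [LinearMap.domRestrict_apply, Matrix.toLin'_apply] using hPmem x) ?_
  refine (injective_iff_map_eq_zero _).2 fun x hx => ?_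
  have hx0 : P *ᵥ (x : ι → ℂ) = 0 := by
    have h0 := congrArg Subtype.val hx
    simpa only [LinearMap.codRestrict_apply, LinearMap.domRestrict_apply, Matrix.toLin'_apply,
      Submodule.coe_zero] using h0
  have hx' : (x : ι → ℂ) = 0 := h x x.2 fun w hw =>
    calc star w ⬝ᵥ (x : ι → ℂ) = star (P *ᵥ w) ⬝ᵥ (x : ι → ℂ) := by rw [hPfix w hw]
      _ = star w ⬝ᵥ Pᴴ *ᵥ (x : ι → ℂ) := by rw [star_mulVec, ← dotProduct_mulVec]
      _ = 0 := by rw [hPH.eq, hx0, dotProduct_zero]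
  exact (Submodule.coe_eq_zero (x := x)).1 hx'

/-- **STUB `stub_floorUpper`** (the floor near `U₀` compresses injectively into the floor at `U₀`).
`A u` Hermitian matrices preserving `K` with quadratic forms `d`-Lipschitz in `u`; `m u` the bottom of
`A u` on `K` (a lower bound attained at an eigenvector in `K`); a strict gap `μ₀ > m U₀` above the
floor at `U₀`. Then for `u` near `U₀` no non-zero vector of the floor of `A u` in `K` is orthogonal
to the floor of `A U₀`, hence (orthogonal compression) the floor dimension does not increase.
Variational perturbation theory: with `r = d |u - U₀| < (μ₀ - m U₀) / 4`, `m u ≤ m U₀ + r`, and a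
floor vector `v` of `u` orthogonal to the floor of `U₀` has
`μ₀ ‖v‖² ≤ Re ⟨v, A U₀ v⟩ ≤ (m u + r) ‖v‖² ≤ (m U₀ + 2r) ‖v‖²`, so `v = 0`; then
`floorUpper_finrank_le_of_orthogonal`. Kato (1966) II §5.1; Tasaki (2020) §2.1. [folklore] -/
theorem stub_floorUpper {ι : Type*} [Fintype ι] [DecidableEq ι] (A : ℝ → Matrix ι ι ℂ)
    (hherm : ∀ u, (A u)ᴴ = A u) (K : Submodule ℂ (ι → ℂ)) (hinv : ∀ u, ∀ v ∈ K, A u *ᵥ v ∈ K)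
    (d : ℝ) (hd : 0 ≤ d)
    (hlip : ∀ (u u' : ℝ) (v : ι → ℂ), |(star v ⬝ᵥ A u *ᵥ v).re - (star v ⬝ᵥ A u' *ᵥ v).re| ≤
      d * |u - u'| * (star v ⬝ᵥ v).re)
    (m : ℝ → ℝ) (hm : ∀ (u : ℝ), ∀ v ∈ K, m u * (star v ⬝ᵥ v).re ≤ (star v ⬝ᵥ A u *ᵥ v).re)
    (hatt : ∀ u : ℝ, ∃ ψ ∈ K, ψ ≠ 0 ∧ A u *ᵥ ψ = (m u : ℂ) • ψ)
    (U₀ μ₀ : ℝ) (hμ₀ : m U₀ < μ₀)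
    (hgap : ∀ w ∈ K, (∀ ψ ∈ K, A U₀ *ᵥ ψ = (m U₀ : ℂ) • ψ → star ψ ⬝ᵥ w = 0) →
      μ₀ * (star w ⬝ᵥ w).re ≤ (star w ⬝ᵥ A U₀ *ᵥ w).re) :
    ∃ ε : ℝ, 0 < ε ∧ ∀ u : ℝ, |u - U₀| < ε →
      (∀ v ∈ K ⊓ Module.End.eigenspace (Matrix.toLin' (A u)) ((m u : ℝ) : ℂ),
        (∀ w ∈ K ⊓ Module.End.eigenspace (Matrix.toLin' (A U₀)) ((m U₀ : ℝ) : ℂ),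
          star w ⬝ᵥ v = 0) → v = 0) ∧
      Module.finrank ℂ ↥(K ⊓ Module.End.eigenspace (Matrix.toLin' (A u)) ((m u : ℝ) : ℂ)) ≤
        Module.finrank ℂ ↥(K ⊓ Module.End.eigenspace (Matrix.toLin' (A U₀)) ((m U₀ : ℝ) : ℂ)) := by
  -- Hermiticity and the invariance of `K` belong to the registered interface of the floor pencil
  -- (they are used by the twin `stub_floorLower`); the variational argument below needs neither.
  have _ := hherm
  have _ := hinv
  -- the window `|u - U₀| < (μ₀ - m U₀) / (4 (d + 1))`
  have hg : 0 < μ₀ - m U₀ := sub_pos.2 hμ₀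
  have h4d : 0 < 4 * (d + 1) := by linarith
  refine ⟨(μ₀ - m U₀) / (4 * (d + 1)), div_pos hg h4d, fun u hu => ?_⟩
  -- `r = d |u - U₀|` has `4 r < μ₀ - m U₀`
  have hr : 4 * (d * |u - U₀|) < μ₀ - m U₀ := by
    have h := (lt_div_iff₀ h4d).1 hu
    nlinarith [abs_nonneg (u - U₀)]
  have hr0 : 0 ≤ d * |u - U₀| := mul_nonneg hd (abs_nonneg _)
  -- the bottom is `d`-Lipschitz from above: `m u ≤ m U₀ + r` (test `A u` on a floor vector of `U₀`)
  have hmu : m u ≤ m U₀ + d * |u - U₀| := by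
    obtain ⟨ψ, hψK, hψ0, hψ⟩ := hatt U₀
    have hpos := re_star_dotProduct_self_pos hψ0
    have h1 := hm u ψ hψK
    have h2 := hlip u U₀ ψ
    rw [re_star_dotProduct_mulVec_of_eigen hψ] at h2
    have h3 : m u * (star ψ ⬝ᵥ ψ).re ≤ (m U₀ + d * |u - U₀|) * (star ψ ⬝ᵥ ψ).re := by
      have := (abs_le.1 h2).2
      linarith
    exact le_of_mul_le_mul_right h3 hpos
  -- membership in a floor
  have hmem : ∀ (u' : ℝ) (v : ι → ℂ),
      v ∈ K ⊓ Module.End.eigenspace (Matrix.toLin' (A u')) ((m u' : ℝ) : ℂ) ↔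
        v ∈ K ∧ A u' *ᵥ v = ((m u' : ℝ) : ℂ) • v := fun u' v => by
    rw [Submodule.mem_inf, Module.End.mem_eigenspace_iff, Matrix.toLin'_apply]
  -- (i) no non-zero floor vector of `u` is orthogonal to the floor of `U₀`
  have hpart1 : ∀ v ∈ K ⊓ Module.End.eigenspace (Matrix.toLin' (A u)) ((m u : ℝ) : ℂ),
      (∀ w ∈ K ⊓ Module.End.eigenspace (Matrix.toLin' (A U₀)) ((m U₀ : ℝ) : ℂ),
        star w ⬝ᵥ v = 0) → v = 0 := by
    intro v hv horth
    obtain ⟨hvK, hveig⟩ := (hmem u v).1 hv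
    -- the gap at `U₀` applies to `v`
    have h1 : μ₀ * (star v ⬝ᵥ v).re ≤ (star v ⬝ᵥ A U₀ *ᵥ v).re :=
      hgap v hvK fun ψ hψK hψ => horth ψ ((hmem U₀ ψ).2 ⟨hψK, hψ⟩)
    -- the form of `A U₀` on `v` is within `r ‖v‖²` of `Re ⟨v, A u v⟩ = m u ‖v‖²`
    have h2 := hlip U₀ u v
    rw [abs_sub_comm U₀ u, re_star_dotProduct_mulVec_of_eigen hveig] at h2
    have h3 := (abs_le.1 h2).2
    have h4 : m u * (star v ⬝ᵥ v).re ≤ (m U₀ + d * |u - U₀|) * (star v ⬝ᵥ v).re :=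
      mul_le_mul_of_nonneg_right hmu (re_star_dotProduct_self_nonneg v)
    have h5 : (μ₀ - m U₀ - 2 * (d * |u - U₀|)) * (star v ⬝ᵥ v).re ≤ 0 := by linarith
    have hc : 0 < μ₀ - m U₀ - 2 * (d * |u - U₀|) := by linarith
    by_contra hv0
    have h6 := mul_pos hc (re_star_dotProduct_self_pos hv0)
    linarith
  -- (ii) the orthogonal compression onto the floor of `U₀` is injective on the floor of `u`
  exact ⟨hpart1, floorUpper_finrank_le_of_orthogonal _ _ hpart1⟩

end Summit.HubbardSuperconductivity.HubbardSuperconductivity.Theorems.JosephsonMirror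

end
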